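import Summits.QuantumFields.BalabanUV.Beta.GAN24.ScalarFlatLift

/-!
# G-an2-4 ∕ (CONV-C), the SCALAR second-order sup letters — part 2b: THE TWO DICTIONARIES between Bałaban's fine torus and the
# NE3 carrier for the scalar averaged propagator `𝒢′ = (Δ + a′Π′)⁻¹`: zeroth-order BLOCK rows of `𝒢′` IN (as cube rows of
# `Gs = n²·RI j (Re 𝒢′ ⊗ 1)`), column ∕ row differences of `Gs` OUT (as the entries of the `η`-normalised `𝒢′∂ᴴ`, `𝒢′∂ᴴ∂ᴴ`, `∂𝒢′`, `∂ᴴ∂𝒢′`)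

G-an2-4 formalisation swarm `b2b-balaban-gan24-formalise-*`, leaf prover 06 (gen 35), crux team (2) under the coordinator ruling
«YM REDIRECT» (e34b3e0c); sequel of `GAN24/ScalarFlatLift` (the lift `A ↦ RI j (A ⊗ₖ 1)`, `n⁻²·RI j (Re Δ′ ⊗ 1) = stencilE + Ms`,
`K·G = 1 = G·K`).  The abstract flat resolvent step (`GAN24/FlatResolventStep.resolventStep_bounds`) consumes a ZEROTH-order cube-row
bound for `Gs` and produces cube-row bounds for `rowDiff ν Gs`, `rowDiff μ (rowDiff ν Gs)`, `Gs·colDiff ν`, `Gs·colDiff μ·colDiff ν`.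
THIS FILE connects both ends to the scalar objects the road-P2 consumer (`GAN24/StaircaseLaplacianDefect` → `SoftMinimiserOneStepSup`)
and leaf-04's reduction engines (`GAN24/ScalarSupReductions`, staged) speak:
 * §1 **`cubeSum_Gs_le_of_block_rows`** (INPUT): a Bałaban-block row bound `Σ_{r′} ‖𝒢′(n·x̄ + r, n·x̄′ + r′)‖ ≤ C·e^{−δ₀|x − x′|_{T₁,∞}}`
   at `(n, M) = (L^j, N·L^{k−j})` — the ROW shape of the (s0)∕(K₀ˢ) END announced by leaf-01 gen 55 (`gps_block_row_sum_le`) — gives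
   `Σ_{z ∈ Δ_j(b)} |Gs(p,z)| ≤ C·(L^j)²·e^{−(δ₀/(d+1))·nbd_j(Δ(p),b)}`, the hypothesis (K₀) of `resolventStep_bounds` with
   `(C_G, δ_G) = (C, δ₀/(d+1))` (NE3's `nbd_le_torusSupNorm`);
 * §2 (OUTPUT) `mul_conjTranspose_apply_of_isReal`, `mul_apply_eq_mulVec_col`, the entries **`Gps_mul_sdiffH_apply`**
   `(𝒢′∂_νᴴ)(a,b) = n·(𝒢′(a,b+e_ν) − 𝒢′(a,b))`, **`Gps_mul_sdiffH_mul_sdiffH_apply`**, **`sdiff_mul_Gps_apply`**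
   `(∂_ν𝒢′)(a,b) = n·(𝒢′(a+e_ν,b) − 𝒢′(a,b))`, **`sdiffH_mul_sdiff_mul_Gps_apply`**, their norms for the REAL matrix `𝒢′`, the carrier
   entries **`Gs_mul_colDiff_apply`**, **`Gs_mul_colDiff_mul_colDiff_apply`**, **`rowDiff_Gs_apply`**, **`rowDiff_rowDiff_Gs_apply`**,
   and the four identities (`∂_ν = sdiff (fine n M) n ν`, `η`-normalised)
   **`abs_Gs_mul_colDiff_eq`** `|(Gs·colDiff ν)(z,x)| = [z₂ = x₂]·n·‖(𝒢′·∂_νᴴ)(eF z₁, eF x₁)‖` (letter (L1) `G′∇*`),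
   **`abs_Gs_mul_colDiff_mul_colDiff_eq`** `|(Gs·colDiff μ·colDiff ν)(z,x)| = [z₂ = x₂]·‖(𝒢′·∂_μᴴ·∂_νᴴ)(eF z₁, eF x₁)‖` ((L3) `G′∇*∇*`),
   **`abs_rowDiff_Gs_eq`** `|rowDiff ν Gs (p,q)| = [p₂ = q₂]·n·‖(∂_ν·𝒢′)(eF p₁, eF q₁)‖` ((L2) `∇G′`),
   **`abs_rowDiff_rowDiff_Gs_eq`** `|rowDiff μ (rowDiff ν Gs)((z − e_μ, c),(x, c′))| = [c = c′]·‖(∂_μᴴ·∂_ν·𝒢′)(eF z, eF x)‖` ((L4) `∇*∇G′`,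
   one backward unit shift of the row): a cube row of each of part 1's four conclusions IS a Bałaban-block row of the corresponding
   `η`-normalised scalar operator (times `n` at first order, against `B·L^j`; times `1` at second order, against `B·(1 + log L^j)`) —
   no power of `n` is left over.

HONEST SCOPE.  [folklore] finite-dimensional bookkeeping over tree modules BY NAME; no estimate is proved here (the block rows of `𝒢′`
are a HYPOTHESIS shape in §1); no `def`, no `def … : Prop`, no `sorry`.  NOT (CONV-C), NEVER «G-an2-4 closed», NOT NE2 ∕ NE3, NOT D1,
NOT BetaPertH, NOT continuum, NOT Clay; not in print — our bookkeeping.  ABSOLUTE RULE of the cell kept.  HONEST DEPENDENCY: continuum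
YM on T⁴ ⇐ BetaPertH ∧ nine spine estimates (0/9 proved); BetaPertH ⇐ (D1) ∧ (D4) ∧ CAP+tail; G-an2-4 gates asym, D1 and NE2/3/4.
-/

noncomputable section

open scoped BigOperators ComplexConjugate Matrix Kronecker
open Finset

namespace Summit.QuantumFields.BalabanUV.Beta.GAN24.ScalarFlatDictionary

open Literature.MathematicalPhysics.QuantumFieldTheory.Balaban1983to89
open Literature.MathematicalPhysics.QuantumFieldTheory.Balaban1983to89.TreeLengthTorus (TPt)
open Literature.MathematicalPhysics.QuantumFieldTheory.Balaban1983to89.B5Prop11Plancherel (Tor fine unitVec)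
open Literature.MathematicalPhysics.QuantumFieldTheory.Balaban1983to89.B5Action121 (sdiff LapS sdiff_mulVec sdiff_conjTranspose_mulVec)
open Literature.MathematicalPhysics.QuantumFieldTheory.Balaban1983to89.B5Block118 (bpt)
open Literature.MathematicalPhysics.QuantumFieldTheory.Balaban1983to89.B5Blocks16 (blockOf_bpt bpt_bijective)
open Literature.MathematicalPhysics.QuantumFieldTheory.Balaban1983to89.B6LowerBound2153Torus (toT)
open Literature.MathematicalPhysics.QuantumFieldTheory.Balaban1983to89.B4TorusKernel.MultiPeriod (torusSupNorm)
open Literature.MathematicalPhysics.QuantumFieldTheory.Balaban1983to89.B5RealFields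
  (IsReal reM reM_add reM_smul_ofReal reM_one isReal_LapS isReal_QsOp)
open Summit.QuantumFields.BalabanUV.T4Continuum
open Summit.QuantumFields.BalabanUV.T4Continuum.SliceTorusBlocks (npl1)
open SliceTorusTower SliceCovariantTower SliceFlatPropagator SliceFlatOperators SliceFlatStencil
open Summit.QuantumFields.BalabanUV.T4Continuum.SliceFlatFreeResolvent (rowDiff)
open Summit.QuantumFields.BalabanUV.T4Continuum.SliceFlatGradientPrep (colDiff mul_colDiff_apply)
open Summit.QuantumFields.BalabanUV.T4Continuum.GradientRowSumTransport (blockOf_eF)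
open Summit.QuantumFields.BalabanUV.T4Continuum.ScalarBlockPoincare (PiS)
open Summit.QuantumFields.BalabanUV.T4Continuum.ScalarAveragedPropagator (DeltaPs Gps DeltaPs_mul_Gps Gps_mul_DeltaPs)
open Summit.QuantumFields.BalabanUV.T4Continuum.CTScalarGreen (LapS_apply)
open Summit.QuantumFields.BalabanUV.T4Continuum.ScalarCovariantCTDefects (PiS_apply)
open Summit.QuantumFields.BalabanUV.Beta.GAN24.ScalarFlatLift

variable (d k N L : ℕ) [NeZero N] [NeZero L]

/-! ## §1  The zeroth-order input: Bałaban-block rows of `𝒢′` ARE cube rows of `Gs` -/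
section Input

variable {d k N L}

/-- **CUBE ROWS OF `Gs = n²·RI j (Re 𝒢′ ⊗ 1)` FROM BAŁABAN-BLOCK ROWS OF `𝒢′`** — the junction with the (s0)∕(K₀ˢ) item: if for the
level-`j` fine torus (`n = L^j` sites per block side, `N·L^{k−j}` blocks per direction, `j ≤ k`) the block rows of the scalar
averaged propagator obey `Σ_{r′} ‖𝒢′(n·x̄ + r, n·x̄′ + r′)‖ ≤ C·e^{−δ₀·|x − x′|_{T₁,∞}}` (the ROW shape of leaf-01's announced END
`gps_block_row_sum_le`, at this `(n, M)`), then for every row `p` and cube `b` of the NE3 carrier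
`Σ_{z ∈ Δ_j(b)} |Gs(p,z)| ≤ C·(L^j)²·e^{−(δ₀/(d+1))·nbd_j(Δ(p), b)}` — part 1's hypothesis (K₀) with `C_G = C`, `δ_G = δ₀/(d+1)`
(NE3's `nbd_le_torusSupNorm`: ℓ¹ block distance `≤ (d+1)·`ℓ^∞ torus distance). [folklore] -/
theorem cubeSum_Gs_le_of_block_rows {a' C δ₀ : ℝ} (hδ₀ : 0 ≤ δ₀) {j : ℕ} (hj : j ≤ k)
    (hrow : ∀ (x x' : Fin (d + 1) → ℤ) (r : Fin (d + 1) → Fin (side k L j)),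
      ∑ r' : Fin (d + 1) → Fin (side k L j),
          ‖Gps (side k L j) (Mlev d k N L j) a' (bpt (side k L j) (Mlev d k N L j) (toT (Mlev d k N L j) x) r)
              (bpt (side k L j) (Mlev d k N L j) (toT (Mlev d k N L j) x') r')‖
        ≤ C * Real.exp (-(δ₀ * torusSupNorm (Mlev d k N L j) (x - x'))))
    (p : TPt (d + 1) (N * L ^ k) × Fin (d + 1)) (b : TPt (d + 1) (levM k N L j)) :
    ∑ z ∈ Finset.univ.filter (fun z => cubeI (d + 1) k N L (Fin (d + 1)) j z = b),
        |(((side k L j : ℝ) ^ 2) • RI d k N L j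
            (reM (Gps (side k L j) (Mlev d k N L j) a') ⊗ₖ (1 : Matrix (Fin (d + 1)) (Fin (d + 1)) ℝ))) p z|
      ≤ C * ((L : ℝ) ^ j) ^ 2
        * Real.exp (-(δ₀ / (d + 1) * nbd (d + 1) k N L j (cubeI (d + 1) k N L (Fin (d + 1)) j p) b)) := by
  have hn0 : (0 : ℝ) ≤ ((side k L j : ℝ)) ^ 2 := by positivity
  have hside : ((side k L j : ℕ) : ℝ) = (L : ℝ) ^ j := by rw [side, min_eq_left hj, Nat.cast_pow]
  -- pull out `n²` and read the cube row as a block row of `|Re 𝒢′| ≤ ‖𝒢′‖`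
  have h1 : ∑ z ∈ Finset.univ.filter (fun z => cubeI (d + 1) k N L (Fin (d + 1)) j z = b),
        |(((side k L j : ℝ) ^ 2) • RI d k N L j
            (reM (Gps (side k L j) (Mlev d k N L j) a') ⊗ₖ (1 : Matrix (Fin (d + 1)) (Fin (d + 1)) ℝ))) p z|
      = ((side k L j : ℝ)) ^ 2 * ∑ r' : Fin (d + 1) → Fin (side k L j),
          |reM (Gps (side k L j) (Mlev d k N L j) a') (eF d k N L j p.1) (bpt (side k L j) (Mlev d k N L j) b r')| := by
    rw [← cubeSum_RI_kron, Finset.mul_sum]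
    refine Finset.sum_congr rfl fun z _ => ?_
    rw [Matrix.smul_apply, smul_eq_mul, abs_mul, abs_of_nonneg hn0]
  -- the row site as a block point of its own cube, both cubes as classes of their values
  set y : TPt (d + 1) (levM k N L j) := cube (d + 1) k N L j p.1 with hy
  obtain ⟨r, hr⟩ := (cube_eq_iff_exists_bpt d k N L j p.1 y).1 rfl
  set x : Fin (d + 1) → ℤ := fun μ => ((y μ).val : ℤ) with hx
  set x' : Fin (d + 1) → ℤ := fun μ => ((b μ).val : ℤ) with hx'
  have hyx : toT (Mlev d k N L j) x = y := toT_val d k N L j y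
  have hbx : toT (Mlev d k N L j) x' = b := toT_val d k N L j b
  have h2 : ∑ r' : Fin (d + 1) → Fin (side k L j),
        |reM (Gps (side k L j) (Mlev d k N L j) a') (eF d k N L j p.1) (bpt (side k L j) (Mlev d k N L j) b r')|
      ≤ C * Real.exp (-(δ₀ * torusSupNorm (Mlev d k N L j) (x - x'))) := by
    have h := hrow x x' r
    rw [hyx, hbx, ← hr] at h
    refine le_trans (Finset.sum_le_sum fun r' _ => ?_) h
    rw [reM, Matrix.map_apply]
    exact Complex.abs_re_le_norm _
  -- the constant is nonnegative
  have hC : 0 ≤ C :=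
    (mul_nonneg_iff_of_pos_right (Real.exp_pos _)).mp ((Finset.sum_nonneg fun r' _ => abs_nonneg _).trans h2)
  -- the distance dictionary
  have hT := nbd_le_torusSupNorm (d := d) (k := k) (N := N) (L := L) j y b
  have hTx : torusSupNorm (Mlev d k N L j) (fun μ => ((y μ).val : ℤ) - ((b μ).val : ℤ)) = torusSupNorm (Mlev d k N L j) (x - x') :=
    rfl
  rw [hTx] at hT
  have hd1 : (0 : ℝ) < d + 1 := by positivity
  have hexp : Real.exp (-(δ₀ * torusSupNorm (Mlev d k N L j) (x - x')))
      ≤ Real.exp (-(δ₀ / (d + 1) * nbd (d + 1) k N L j (cubeI (d + 1) k N L (Fin (d + 1)) j p) b)) := by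
    rw [Real.exp_le_exp, neg_le_neg_iff, cubeI_apply, ← hy, div_mul_eq_mul_div, div_le_iff₀ hd1]
    calc δ₀ * (nbd (d + 1) k N L j y b : ℝ) ≤ δ₀ * ((d + 1) * torusSupNorm (Mlev d k N L j) (x - x')) :=
          mul_le_mul_of_nonneg_left hT hδ₀
      _ = δ₀ * torusSupNorm (Mlev d k N L j) (x - x') * (d + 1) := by ring
  rw [h1]
  calc ((side k L j : ℝ)) ^ 2 * ∑ r' : Fin (d + 1) → Fin (side k L j),
          |reM (Gps (side k L j) (Mlev d k N L j) a') (eF d k N L j p.1) (bpt (side k L j) (Mlev d k N L j) b r')|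
      ≤ ((side k L j : ℝ)) ^ 2 * (C * Real.exp (-(δ₀ * torusSupNorm (Mlev d k N L j) (x - x')))) :=
        mul_le_mul_of_nonneg_left h2 hn0
    _ ≤ ((side k L j : ℝ)) ^ 2 * (C * Real.exp (-(δ₀ / (d + 1) * nbd (d + 1) k N L j (cubeI (d + 1) k N L (Fin (d + 1)) j p) b))) :=
        mul_le_mul_of_nonneg_left (mul_le_mul_of_nonneg_left hexp hC) hn0
    _ = C * ((L : ℝ) ^ j) ^ 2
        * Real.exp (-(δ₀ / (d + 1) * nbd (d + 1) k N L j (cubeI (d + 1) k N L (Fin (d + 1)) j p) b)) := by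
        rw [hside]; ring

end Input

/-! ## §2  The output dictionary: column differences of `Gs` ARE the entries of `𝒢′∂ᴴ`, `𝒢′∂ᴴ∂ᴴ` -/
section Output

variable {ι : Type*} [Fintype ι]

/-- Right multiplication by the adjoint of a REAL matrix acts on a row as the matrix itself: `(A·Bᴴ)(a,b) = (B·A(a,·))(b)`.
[folklore] -/
theorem mul_conjTranspose_apply_of_isReal (A B : Matrix ι ι ℂ) (hB : IsReal B) (a b : ι) :
    (A * Bᴴ) a b = (B *ᵥ fun y => A a y) b := by
  simp only [Matrix.mul_apply, Matrix.conjTranspose_apply, Matrix.mulVec, dotProduct]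
  refine Finset.sum_congr rfl fun y _ => ?_
  rw [Complex.star_def, hB b y, mul_comm]

variable {D : ℕ} (n : ℕ) [NeZero n] (M : Fin D → ℕ) [∀ μ, NeZero (M μ)] (a' : ℝ)

/-- **Entries of `𝒢′·∂_νᴴ`** (`∂_ν = sdiff (fine n M) n ν`, the `η`-lattice forward difference):
`(𝒢′∂_νᴴ)(a,b) = n·(𝒢′(a, b + e_ν) − 𝒢′(a,b))`. [folklore] -/
theorem Gps_mul_sdiffH_apply (ν : Fin D) (a b : Tor (fine n M)) :
    (Gps n M a' * (sdiff (fine n M) (n : ℂ) ν)ᴴ) a b = (n : ℂ) * (Gps n M a' a (b + unitVec (fine n M) ν) - Gps n M a' a b) := by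
  rw [mul_conjTranspose_apply_of_isReal _ _ (B5RealFields.isReal_sdiff (fine n M) (Complex.conj_natCast n) ν), sdiff_mulVec]

/-- **Entries of `𝒢′·∂_μᴴ·∂_νᴴ`**: `n·(n·(𝒢′(a,b+e_ν+e_μ) − 𝒢′(a,b+e_ν)) − n·(𝒢′(a,b+e_μ) − 𝒢′(a,b)))`. [folklore] -/
theorem Gps_mul_sdiffH_mul_sdiffH_apply (μ ν : Fin D) (a b : Tor (fine n M)) :
    (Gps n M a' * (sdiff (fine n M) (n : ℂ) μ)ᴴ * (sdiff (fine n M) (n : ℂ) ν)ᴴ) a b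
      = (n : ℂ) * ((n : ℂ) * (Gps n M a' a (b + unitVec (fine n M) ν + unitVec (fine n M) μ) - Gps n M a' a (b + unitVec (fine n M) ν))
          - (n : ℂ) * (Gps n M a' a (b + unitVec (fine n M) μ) - Gps n M a' a b)) := by
  rw [mul_conjTranspose_apply_of_isReal _ _ (B5RealFields.isReal_sdiff (fine n M) (Complex.conj_natCast n) ν), sdiff_mulVec,
    Gps_mul_sdiffH_apply, Gps_mul_sdiffH_apply]

/-- norms of first differences of the real matrix `𝒢′`: `‖n·(𝒢′(a,b) − 𝒢′(a,b′))‖ = n·|Re 𝒢′(a,b) − Re 𝒢′(a,b′)|`. [folklore] -/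
theorem norm_Gps_mul_sdiffH_apply (ν : Fin D) (a b : Tor (fine n M)) :
    ‖(Gps n M a' * (sdiff (fine n M) (n : ℂ) ν)ᴴ) a b‖
      = n * |(Gps n M a' a (b + unitVec (fine n M) ν)).re - (Gps n M a' a b).re| := by
  have hG := isReal_Gps n M a'
  rw [Gps_mul_sdiffH_apply]
  have e : Gps n M a' a (b + unitVec (fine n M) ν) - Gps n M a' a b
      = (((Gps n M a' a (b + unitVec (fine n M) ν)).re - (Gps n M a' a b).re : ℝ) : ℂ) := by
    apply Complex.ext
    · simp
    · simp [hG.im_eq_zero]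
  rw [e, norm_mul, Complex.norm_natCast, Complex.norm_real, Real.norm_eq_abs]

/-- norms of second differences of the real matrix `𝒢′`. [folklore] -/
theorem norm_Gps_mul_sdiffH_mul_sdiffH_apply (μ ν : Fin D) (a b : Tor (fine n M)) :
    ‖(Gps n M a' * (sdiff (fine n M) (n : ℂ) μ)ᴴ * (sdiff (fine n M) (n : ℂ) ν)ᴴ) a b‖
      = (n : ℝ) ^ 2 * |(Gps n M a' a (b + unitVec (fine n M) ν + unitVec (fine n M) μ)).re
          - (Gps n M a' a (b + unitVec (fine n M) ν)).re - (Gps n M a' a (b + unitVec (fine n M) μ)).re + (Gps n M a' a b).re| := by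
  have hG := isReal_Gps n M a'
  have hc : ∀ y, Gps n M a' a y = (((Gps n M a' a y).re : ℝ) : ℂ) := fun y =>
    Complex.ext (by simp) (by simp [hG.im_eq_zero])
  rw [Gps_mul_sdiffH_mul_sdiffH_apply]
  have e : (n : ℂ) * ((n : ℂ) * (Gps n M a' a (b + unitVec (fine n M) ν + unitVec (fine n M) μ) - Gps n M a' a (b + unitVec (fine n M) ν))
          - (n : ℂ) * (Gps n M a' a (b + unitVec (fine n M) μ) - Gps n M a' a b))
      = ((((n : ℝ) ^ 2 * ((Gps n M a' a (b + unitVec (fine n M) ν + unitVec (fine n M) μ)).re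
          - (Gps n M a' a (b + unitVec (fine n M) ν)).re - (Gps n M a' a (b + unitVec (fine n M) μ)).re + (Gps n M a' a b).re) : ℝ)) : ℂ) := by
    conv_lhs => rw [hc (b + unitVec (fine n M) ν + unitVec (fine n M) μ), hc (b + unitVec (fine n M) ν),
      hc (b + unitVec (fine n M) μ), hc b]
    push_cast
    ring
  rw [e, Complex.norm_real, Real.norm_eq_abs, abs_mul, abs_of_nonneg (by positivity)]

/-- A column of a matrix product is the matrix acting on the column: `(A·B)(a,b) = (A·B(·,b))(a)`. [folklore] -/
theorem mul_apply_eq_mulVec_col (A B : Matrix ι ι ℂ) (a b : ι) : (A * B) a b = (A *ᵥ fun y => B y b) a := by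
  simp only [Matrix.mul_apply, Matrix.mulVec, dotProduct]

/-- norm of `n·(z₁ − z₂)` for REAL complex numbers. [folklore] -/
theorem norm_natCast_mul_sub_of_im {z₁ z₂ : ℂ} (h₁ : z₁.im = 0) (h₂ : z₂.im = 0) (m : ℕ) :
    ‖(m : ℂ) * (z₁ - z₂)‖ = m * |z₁.re - z₂.re| := by
  have e : z₁ - z₂ = ((z₁.re - z₂.re : ℝ) : ℂ) := Complex.ext (by simp) (by simp [h₁, h₂])
  rw [e, norm_mul, Complex.norm_natCast, Complex.norm_real, Real.norm_eq_abs]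

/-- norm of `n·(n·(z₁ − z₂) − n·(z₃ − z₄))` for REAL complex numbers. [folklore] -/
theorem norm_natCast_mul_sub_sub_of_im {z₁ z₂ z₃ z₄ : ℂ} (h₁ : z₁.im = 0) (h₂ : z₂.im = 0) (h₃ : z₃.im = 0) (h₄ : z₄.im = 0)
    (m : ℕ) : ‖(m : ℂ) * ((m : ℂ) * (z₁ - z₂) - (m : ℂ) * (z₃ - z₄))‖ = (m : ℝ) ^ 2 * |z₁.re - z₂.re - z₃.re + z₄.re| := by
  have hc : ∀ z : ℂ, z.im = 0 → z = ((z.re : ℝ) : ℂ) := fun z hz => Complex.ext (by simp) (by simp [hz])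
  have e : (m : ℂ) * ((m : ℂ) * (z₁ - z₂) - (m : ℂ) * (z₃ - z₄))
      = ((((m : ℝ) ^ 2 * (z₁.re - z₂.re - z₃.re + z₄.re)) : ℝ) : ℂ) := by
    conv_lhs => rw [hc z₁ h₁, hc z₂ h₂, hc z₃ h₃, hc z₄ h₄]
    push_cast
    ring
  rw [e, Complex.norm_real, Real.norm_eq_abs, abs_mul, abs_of_nonneg (by positivity)]

/-- **Entries of `∂_ν·𝒢′`** (the ROW form): `(∂_ν𝒢′)(a,b) = n·(𝒢′(a + e_ν, b) − 𝒢′(a,b))`. [folklore] -/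
theorem sdiff_mul_Gps_apply (ν : Fin D) (a b : Tor (fine n M)) :
    (sdiff (fine n M) (n : ℂ) ν * Gps n M a') a b = (n : ℂ) * (Gps n M a' (a + unitVec (fine n M) ν) b - Gps n M a' a b) := by
  rw [mul_apply_eq_mulVec_col, sdiff_mulVec]

/-- **Entries of `∂_μᴴ·∂_ν·𝒢′`** (the ROW form of second order):
`n·(n·(𝒢′(a−e_μ+e_ν,b) − 𝒢′(a−e_μ,b)) − n·(𝒢′(a+e_ν,b) − 𝒢′(a,b)))`. [folklore] -/
theorem sdiffH_mul_sdiff_mul_Gps_apply (μ ν : Fin D) (a b : Tor (fine n M)) :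
    ((sdiff (fine n M) (n : ℂ) μ)ᴴ * sdiff (fine n M) (n : ℂ) ν * Gps n M a') a b
      = (n : ℂ) * ((n : ℂ) * (Gps n M a' (a - unitVec (fine n M) μ + unitVec (fine n M) ν) b - Gps n M a' (a - unitVec (fine n M) μ) b)
          - (n : ℂ) * (Gps n M a' (a + unitVec (fine n M) ν) b - Gps n M a' a b)) := by
  rw [Matrix.mul_assoc, mul_apply_eq_mulVec_col, sdiff_conjTranspose_mulVec, Complex.conj_natCast, sdiff_mul_Gps_apply,
    sdiff_mul_Gps_apply]

/-- norms of the ROW first differences of the real matrix `𝒢′`. [folklore] -/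
theorem norm_sdiff_mul_Gps_apply (ν : Fin D) (a b : Tor (fine n M)) :
    ‖(sdiff (fine n M) (n : ℂ) ν * Gps n M a') a b‖ = n * |(Gps n M a' (a + unitVec (fine n M) ν) b).re - (Gps n M a' a b).re| := by
  have hG := isReal_Gps n M a'
  rw [sdiff_mul_Gps_apply, norm_natCast_mul_sub_of_im (hG.im_eq_zero _ _) (hG.im_eq_zero _ _)]

/-- norms of the ROW second differences of the real matrix `𝒢′`. [folklore] -/
theorem norm_sdiffH_mul_sdiff_mul_Gps_apply (μ ν : Fin D) (a b : Tor (fine n M)) :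
    ‖((sdiff (fine n M) (n : ℂ) μ)ᴴ * sdiff (fine n M) (n : ℂ) ν * Gps n M a') a b‖
      = (n : ℝ) ^ 2 * |(Gps n M a' (a - unitVec (fine n M) μ + unitVec (fine n M) ν) b).re - (Gps n M a' (a - unitVec (fine n M) μ) b).re
          - (Gps n M a' (a + unitVec (fine n M) ν) b).re + (Gps n M a' a b).re| := by
  have hG := isReal_Gps n M a'
  rw [sdiffH_mul_sdiff_mul_Gps_apply, norm_natCast_mul_sub_sub_of_im (hG.im_eq_zero _ _) (hG.im_eq_zero _ _) (hG.im_eq_zero _ _)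
    (hG.im_eq_zero _ _)]

variable (j : ℕ)

/-- **`Gs·colDiff ν` on the carrier**: `(Gs·colDiff ν)(z,x) = [z₂ = x₂]·n²·(Re 𝒢′(eF z₁, eF x₁ + e_ν) − Re 𝒢′(eF z₁, eF x₁))`. [folklore] -/
theorem Gs_mul_colDiff_apply (ν : Fin (d + 1)) (z x : TPt (d + 1) (N * L ^ k) × Fin (d + 1)) :
    ((((side k L j : ℝ) ^ 2) • RI d k N L j
        (reM (Gps (side k L j) (Mlev d k N L j) a') ⊗ₖ (1 : Matrix (Fin (d + 1)) (Fin (d + 1)) ℝ))) * colDiff d k N L ν) z x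
      = if z.2 = x.2 then ((side k L j : ℝ)) ^ 2 *
          ((Gps (side k L j) (Mlev d k N L j) a' (eF d k N L j z.1) (eF d k N L j x.1 + unitVec (fine (side k L j) (Mlev d k N L j)) ν)).re
            - (Gps (side k L j) (Mlev d k N L j) a' (eF d k N L j z.1) (eF d k N L j x.1)).re) else 0 := by
  rw [mul_colDiff_apply, Matrix.smul_apply, Matrix.smul_apply, RI_kron_apply, RI_kron_apply]
  dsimp only
  rw [eF_add, eF_single]
  split_ifs with h
  · rw [smul_eq_mul, smul_eq_mul, reM, Matrix.map_apply, Matrix.map_apply]; ring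
  · simp

/-- **`Gs·colDiff μ·colDiff ν` on the carrier** (the double column difference, read through `eF`). [folklore] -/
theorem Gs_mul_colDiff_mul_colDiff_apply (μ ν : Fin (d + 1)) (z x : TPt (d + 1) (N * L ^ k) × Fin (d + 1)) :
    ((((side k L j : ℝ) ^ 2) • RI d k N L j
        (reM (Gps (side k L j) (Mlev d k N L j) a') ⊗ₖ (1 : Matrix (Fin (d + 1)) (Fin (d + 1)) ℝ)))
        * colDiff d k N L μ * colDiff d k N L ν) z x
      = if z.2 = x.2 then ((side k L j : ℝ)) ^ 2 *
          ((Gps (side k L j) (Mlev d k N L j) a' (eF d k N L j z.1)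
              (eF d k N L j x.1 + unitVec (fine (side k L j) (Mlev d k N L j)) ν + unitVec (fine (side k L j) (Mlev d k N L j)) μ)).re
            - (Gps (side k L j) (Mlev d k N L j) a' (eF d k N L j z.1)
              (eF d k N L j x.1 + unitVec (fine (side k L j) (Mlev d k N L j)) ν)).re
            - (Gps (side k L j) (Mlev d k N L j) a' (eF d k N L j z.1)
              (eF d k N L j x.1 + unitVec (fine (side k L j) (Mlev d k N L j)) μ)).re
            + (Gps (side k L j) (Mlev d k N L j) a' (eF d k N L j z.1) (eF d k N L j x.1)).re) else 0 := by
  rw [mul_colDiff_apply, Gs_mul_colDiff_apply, Gs_mul_colDiff_apply]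
  dsimp only
  rw [eF_add, eF_single]
  split_ifs with h
  · ring
  · simp

/-- **THE FIRST-ORDER DICTIONARY**: `|(Gs·colDiff ν)(z,x)| = [z₂ = x₂]·n·‖(𝒢′·∂_νᴴ)(eF z₁, eF x₁)‖` — a cube row of part 1's
operator-form conclusion `Σ |Gs·colDiff ν| ≤ B·L^j·e^{−δ·nbd}` is `n·` a Bałaban-block row of the `η`-normalised `𝒢′∂_νᴴ`, so the
latter is `≤ B·e^{−δ·nbd}`, n-UNIFORM. [folklore] -/
theorem abs_Gs_mul_colDiff_eq (ν : Fin (d + 1)) (z x : TPt (d + 1) (N * L ^ k) × Fin (d + 1)) :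
    |((((side k L j : ℝ) ^ 2) • RI d k N L j
        (reM (Gps (side k L j) (Mlev d k N L j) a') ⊗ₖ (1 : Matrix (Fin (d + 1)) (Fin (d + 1)) ℝ))) * colDiff d k N L ν) z x|
      = if z.2 = x.2 then (side k L j : ℝ) *
          ‖(Gps (side k L j) (Mlev d k N L j) a' * (sdiff (fine (side k L j) (Mlev d k N L j)) (side k L j : ℂ) ν)ᴴ)
              (eF d k N L j z.1) (eF d k N L j x.1)‖ else 0 := by
  rw [Gs_mul_colDiff_apply, norm_Gps_mul_sdiffH_apply]
  split_ifs with h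
  · rw [abs_mul, abs_of_nonneg (by positivity)]; ring
  · rw [abs_zero]

/-- **THE SECOND-ORDER DICTIONARY**: `|(Gs·colDiff μ·colDiff ν)(z,x)| = [z₂ = x₂]·‖(𝒢′·∂_μᴴ·∂_νᴴ)(eF z₁, eF x₁)‖` — part 1's
operator-form second-order conclusion `Σ |Gs·colDiff μ·colDiff ν| ≤ B·(1 + log L^j)·e^{−δ·nbd}` IS the Bałaban-block row bound of the
`η`-normalised `𝒢′∂_μᴴ∂_νᴴ` (the requester's `‖𝒢′∂′ᴴ∂′ᴴ‖_{∞→∞}` letter, cube by cube). [folklore] -/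
theorem abs_Gs_mul_colDiff_mul_colDiff_eq (μ ν : Fin (d + 1)) (z x : TPt (d + 1) (N * L ^ k) × Fin (d + 1)) :
    |((((side k L j : ℝ) ^ 2) • RI d k N L j
        (reM (Gps (side k L j) (Mlev d k N L j) a') ⊗ₖ (1 : Matrix (Fin (d + 1)) (Fin (d + 1)) ℝ)))
        * colDiff d k N L μ * colDiff d k N L ν) z x|
      = if z.2 = x.2 then
          ‖(Gps (side k L j) (Mlev d k N L j) a' * (sdiff (fine (side k L j) (Mlev d k N L j)) (side k L j : ℂ) μ)ᴴ
              * (sdiff (fine (side k L j) (Mlev d k N L j)) (side k L j : ℂ) ν)ᴴ) (eF d k N L j z.1) (eF d k N L j x.1)‖ else 0 := by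
  rw [Gs_mul_colDiff_mul_colDiff_apply, norm_Gps_mul_sdiffH_mul_sdiffH_apply]
  split_ifs with h
  · rw [abs_mul, abs_of_nonneg (by positivity)]
  · rw [abs_zero]

/-- An absolute value is unchanged by negating its argument, in equation form. [folklore] -/
theorem abs_eq_abs_of_eq_neg {u v : ℝ} (h : u = -v) : |u| = |v| := by rw [h, abs_neg]

/-- **`rowDiff ν Gs` on the carrier**: `[p₂ = q₂]·n²·(Re 𝒢′(eF p₁ + e_ν, eF q₁) − Re 𝒢′(eF p₁, eF q₁))`. [folklore] -/
theorem rowDiff_Gs_apply (ν : Fin (d + 1)) (p q : TPt (d + 1) (N * L ^ k) × Fin (d + 1)) :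
    rowDiff d k N L ν (((side k L j : ℝ) ^ 2) • RI d k N L j
        (reM (Gps (side k L j) (Mlev d k N L j) a') ⊗ₖ (1 : Matrix (Fin (d + 1)) (Fin (d + 1)) ℝ))) p q
      = if p.2 = q.2 then ((side k L j : ℝ)) ^ 2 *
          ((Gps (side k L j) (Mlev d k N L j) a' (eF d k N L j p.1 + unitVec (fine (side k L j) (Mlev d k N L j)) ν) (eF d k N L j q.1)).re
            - (Gps (side k L j) (Mlev d k N L j) a' (eF d k N L j p.1) (eF d k N L j q.1)).re) else 0 := by
  simp only [rowDiff]
  rw [Matrix.smul_apply, Matrix.smul_apply, RI_kron_apply, RI_kron_apply]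
  dsimp only
  rw [eF_add, eF_single]
  split_ifs with h
  · rw [smul_eq_mul, smul_eq_mul, reM, Matrix.map_apply, Matrix.map_apply]; ring
  · simp

/-- **`rowDiff μ (rowDiff ν Gs)` on the carrier** (the double row difference, read through `eF`). [folklore] -/
theorem rowDiff_rowDiff_Gs_apply (μ ν : Fin (d + 1)) (p q : TPt (d + 1) (N * L ^ k) × Fin (d + 1)) :
    rowDiff d k N L μ (rowDiff d k N L ν (((side k L j : ℝ) ^ 2) • RI d k N L j
        (reM (Gps (side k L j) (Mlev d k N L j) a') ⊗ₖ (1 : Matrix (Fin (d + 1)) (Fin (d + 1)) ℝ)))) p q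
      = if p.2 = q.2 then ((side k L j : ℝ)) ^ 2 *
          ((Gps (side k L j) (Mlev d k N L j) a'
              (eF d k N L j p.1 + unitVec (fine (side k L j) (Mlev d k N L j)) μ + unitVec (fine (side k L j) (Mlev d k N L j)) ν)
              (eF d k N L j q.1)).re
            - (Gps (side k L j) (Mlev d k N L j) a' (eF d k N L j p.1 + unitVec (fine (side k L j) (Mlev d k N L j)) μ)
              (eF d k N L j q.1)).re
            - (Gps (side k L j) (Mlev d k N L j) a' (eF d k N L j p.1 + unitVec (fine (side k L j) (Mlev d k N L j)) ν)
              (eF d k N L j q.1)).re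
            + (Gps (side k L j) (Mlev d k N L j) a' (eF d k N L j p.1) (eF d k N L j q.1)).re) else 0 := by
  simp only [rowDiff]
  rw [Matrix.smul_apply, Matrix.smul_apply, Matrix.smul_apply, Matrix.smul_apply, RI_kron_apply, RI_kron_apply, RI_kron_apply,
    RI_kron_apply]
  dsimp only
  simp only [eF_add, eF_single]
  split_ifs with h
  · simp only [smul_eq_mul, reM, Matrix.map_apply]; ring
  · simp

/-- **THE FIRST-ORDER ROW DICTIONARY**: `|rowDiff ν Gs (p,q)| = [p₂ = q₂]·n·‖(∂_ν·𝒢′)(eF p₁, eF q₁)‖` — part 1's row-form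
conclusion `Σ |rowDiff ν Gs| ≤ B·L^j·e^{−δ·nbd}` is `n·` a Bałaban-block row of the `η`-normalised `∂_ν𝒢′` (the requester's `∇G′`
letter). [folklore] -/
theorem abs_rowDiff_Gs_eq (ν : Fin (d + 1)) (p q : TPt (d + 1) (N * L ^ k) × Fin (d + 1)) :
    |rowDiff d k N L ν (((side k L j : ℝ) ^ 2) • RI d k N L j
        (reM (Gps (side k L j) (Mlev d k N L j) a') ⊗ₖ (1 : Matrix (Fin (d + 1)) (Fin (d + 1)) ℝ))) p q|
      = if p.2 = q.2 then (side k L j : ℝ) *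
          ‖(sdiff (fine (side k L j) (Mlev d k N L j)) (side k L j : ℂ) ν * Gps (side k L j) (Mlev d k N L j) a')
              (eF d k N L j p.1) (eF d k N L j q.1)‖ else 0 := by
  rw [rowDiff_Gs_apply, norm_sdiff_mul_Gps_apply]
  split_ifs with h
  · rw [abs_mul, abs_of_nonneg (by positivity)]; ring
  · rw [abs_zero]

/-- **THE SECOND-ORDER ROW DICTIONARY** (one backward unit shift of the row): for carrier sites `z, x` and internal indices `c, c′`,
`|rowDiff μ (rowDiff ν Gs)((z − e_μ, c), (x, c′))| = [c = c′]·‖(∂_μᴴ·∂_ν·𝒢′)(eF z, eF x)‖` — part 1's row-form second-order conclusion,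
read at the row shifted back by `e_μ`, IS a Bałaban-block row of the `η`-normalised `∂_μᴴ∂_ν𝒢′` (the requester's `∇*∇G′` letter).
[folklore] -/
theorem abs_rowDiff_rowDiff_Gs_eq (μ ν : Fin (d + 1)) (z x : TPt (d + 1) (N * L ^ k)) (c c' : Fin (d + 1)) :
    |rowDiff d k N L μ (rowDiff d k N L ν (((side k L j : ℝ) ^ 2) • RI d k N L j
        (reM (Gps (side k L j) (Mlev d k N L j) a') ⊗ₖ (1 : Matrix (Fin (d + 1)) (Fin (d + 1)) ℝ))))
        ((z - Pi.single μ 1, c) : TPt (d + 1) (N * L ^ k) × Fin (d + 1)) (x, c')|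
      = if c = c' then
          ‖((sdiff (fine (side k L j) (Mlev d k N L j)) (side k L j : ℂ) μ)ᴴ * sdiff (fine (side k L j) (Mlev d k N L j)) (side k L j : ℂ) ν
              * Gps (side k L j) (Mlev d k N L j) a') (eF d k N L j z) (eF d k N L j x)‖ else 0 := by
  rw [rowDiff_rowDiff_Gs_apply, norm_sdiffH_mul_sdiff_mul_Gps_apply]
  dsimp only
  rw [eF_sub, eF_single]
  split_ifs with h
  · rw [abs_mul, abs_of_nonneg (by positivity), sub_add_cancel]
    congr 1
    exact abs_eq_abs_of_eq_neg (by ring)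
  · rw [abs_zero]

end Output

end Summit.QuantumFields.BalabanUV.Beta.GAN24.ScalarFlatDictionary
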